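import Mathlib.Analysis.Calculus.MeanValue
import Literature.MeasureTheory.Hausdorff.OrthogonalProductVolume
import Literature.MeasureTheory.Hausdorff.SphereAreaGeneral
import HarnessLib

/-!
# Round cylinders `S_V × Vᗮ`: Lipschitz graph patches and finiteness of the Hausdorff measure

Let `E` be a real inner product space of dimension `n + 1`, `V ≤ E` a subspace of dimension
`k + 1` and `Cyl = {z | ‖P_V z‖ = 1}` the round unit cylinder over `V` (the generalized cylinder
`S^k × ℝ^{n-k}` of mean curvature flow, up to scale). This file provides the local comparison of
`μHE[n]⌊Cyl` with Lebesgue measure on an `n`-plane that the identification of `μHE[n]⌊Cyl` with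
the product measure `μHE[k]⌊S_V ⊗ vol_{Vᗮ}` (`CylinderHausdorffMeasure.lean`) and Stone's entropy
values (`Literature.Geometry.Riemannian.Stone1994_cylinderEntropy`) need.

For a unit vector `v ∈ V` put `K₁ = (vᗮ ∩ V) ≤ E` (the image of `(ℝ ∙ v)ᗮ ≤ V`), `W = K₁ ⊔ Vᗮ`
(an `n`-plane, `finrank_patchPlane`), and consider the **patch**
`P(v, c, ρ₂) = {z | P_V z ∈ cap v c, ‖P_{Vᗮ} z‖ < ρ₂}` of `Cyl` and the **box**
`Q = {w ∈ W | ‖P_{K₁} w‖ < √(1 - c²), ‖P_{Vᗮ} w‖ < ρ₂}`: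

* the graph map `G w = w + √(1 - ‖P_{K₁} w‖²) v : W → E` is Lipschitz with constant
  `1 + ρ/√(1 - ρ²)` (`ρ = √(1 - c²)`) on the convex set `Q` (`lipschitzOnWith_patchLift`) and
  `P ⊆ G '' Q` (`patch_subset_image_patchLift`), whence
  `μHE[n] (P) ≤ (1 + ρ/c)^n vol_{K₁}(B_ρ) vol_{Vᗮ}(B_{ρ₂})` (`euclideanHausdorffMeasure_patch_le`,
  using `volume_sup_setOf_orthogonalProjection_mem_prod`);
* (in the continuation `CylinderHausdorffFinite.lean`) finitely many such patches cover every
  bounded piece of the cylinder, so `μHE[n] (Cyl ∩ B(x, R)) < ∞`, and the product measure of a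
  patch is `μHE[k] (cap v c) · vol (B_{ρ₂})`.

No definitions are introduced; `K₁` is passed as a hypothesis `hK₁ : K₁ = ((ℝ ∙ v)ᗮ).map V.subtype`.

## References

* P. Mattila, *Geometry of sets and measures in Euclidean spaces* (1995), §4.3, Thm. 3.4.
* H. Federer, *Geometric measure theory* (1969), 2.10.11, 3.2.
-/

noncomputable section

open Set Metric Module Submodule Filter
open _root_.MeasureTheory _root_.MeasureTheory.Measure
open scoped ENNReal NNReal Topology RealInnerProductSpace Pointwise

namespace Literature.MeasureTheory.Hausdorff

variable {E : Type*} [NormedAddCommGroup E] [InnerProductSpace ℝ E]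

/-! ### The plane `W = (vᗮ ∩ V) ⊕ Vᗮ` -/

section Plane

variable {V : Submodule ℝ E} {v : V} {K₁ : Submodule ℝ E}

/-- Membership in `K₁ = (vᗮ ∩ V)`: the images of the vectors of `V` orthogonal to `v`. [folklore] -/
theorem mem_patchPlane_iff (hK₁ : K₁ = ((ℝ ∙ v)ᗮ : Submodule ℝ V).map V.subtype) {z : E} :
    z ∈ K₁ ↔ ∃ a : V, ⟪v, a⟫ = 0 ∧ (a : E) = z := by
  rw [hK₁, Submodule.mem_map]
  constructor
  · rintro ⟨a, ha, rfl⟩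
    exact ⟨a, (mem_orthogonal_singleton_iff_inner_right).1 ha, rfl⟩
  · rintro ⟨a, ha, rfl⟩
    exact ⟨a, (mem_orthogonal_singleton_iff_inner_right).2 ha, rfl⟩

/-- `K₁ ≤ V`. [folklore] -/
theorem patchPlane_le (hK₁ : K₁ = ((ℝ ∙ v)ᗮ : Submodule ℝ V).map V.subtype) : K₁ ≤ V := by
  rw [hK₁]; exact Submodule.map_subtype_le V _

/-- `K₁ ⟂ Vᗮ`. [folklore] -/
theorem patchPlane_isOrtho (hK₁ : K₁ = ((ℝ ∙ v)ᗮ : Submodule ℝ V).map V.subtype) : K₁ ⟂ Vᗮ :=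
  (Submodule.isOrtho_orthogonal_right V).mono_left (patchPlane_le hK₁)

/-- `v` is orthogonal to `K₁`. [folklore] -/
theorem inner_eq_zero_of_mem_patchPlane (hK₁ : K₁ = ((ℝ ∙ v)ᗮ : Submodule ℝ V).map V.subtype)
    {z : E} (hz : z ∈ K₁) : ⟪(v : E), z⟫ = 0 := by
  obtain ⟨a, ha, rfl⟩ := (mem_patchPlane_iff hK₁).1 hz
  rw [← Submodule.coe_inner, ha]

/-- `v` is orthogonal to the plane `W = K₁ ⊔ Vᗮ`. [folklore] -/
theorem inner_eq_zero_of_mem_patchPlane_sup (hK₁ : K₁ = ((ℝ ∙ v)ᗮ : Submodule ℝ V).map V.subtype)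
    {w : E} (hw : w ∈ K₁ ⊔ Vᗮ) : ⟪(v : E), w⟫ = 0 := by
  obtain ⟨y, hy, z, hz, rfl⟩ := Submodule.mem_sup.1 hw
  rw [inner_add_right, inner_eq_zero_of_mem_patchPlane hK₁ hy,
    Submodule.inner_right_of_mem_orthogonal v.2 hz, add_zero]

variable [FiniteDimensional ℝ E]

omit [FiniteDimensional ℝ E] in
/-- `dim K₁ = k` when `dim V = k + 1` and `‖v‖ = 1`. [folklore] -/
theorem finrank_patchPlane {k : ℕ} (hV : finrank ℝ V = k + 1) (hv : ‖v‖ = 1)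
    (hK₁ : K₁ = ((ℝ ∙ v)ᗮ : Submodule ℝ V).map V.subtype) : finrank ℝ K₁ = k := by
  haveI : Fact (finrank ℝ V = k + 1) := ⟨hV⟩
  have hv0 : v ≠ 0 := fun h ↦ by simp [h] at hv
  have hK : finrank ℝ ((ℝ ∙ v)ᗮ : Submodule ℝ V) = k := finrank_orthogonal_span_singleton hv0
  rw [hK₁, ← hK]
  exact (Submodule.equivMapOfInjective V.subtype V.injective_subtype _).symm.finrank_eq

/-- `dim (K₁ ⊔ Vᗮ) = n` when `dim E = n + 1`, `dim V = k + 1`, `‖v‖ = 1`. [folklore] -/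
theorem finrank_patchPlane_sup {n k : ℕ} (hE : finrank ℝ E = n + 1) (hV : finrank ℝ V = k + 1)
    (hv : ‖v‖ = 1) (hK₁ : K₁ = ((ℝ ∙ v)ᗮ : Submodule ℝ V).map V.subtype) :
    finrank ℝ ↥(K₁ ⊔ Vᗮ) = n := by
  have h1 := finrank_sup_of_isOrtho K₁ Vᗮ (patchPlane_isOrtho hK₁)
  have h2 := Submodule.finrank_add_finrank_orthogonal V
  rw [finrank_patchPlane hV hv hK₁] at h1
  omega

end Plane

/-! ### The graph map over the plane and its Lipschitz constant -/

section Lift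

variable {V : Submodule ℝ E} {v : V} {K₁ : Submodule ℝ E} [FiniteDimensional ℝ E]

/-- The derivative of the graph map `G w = w + √(1 - ‖P_{K₁} w‖²) v` on `W = K₁ ⊔ Vᗮ`, at a point
with `‖P_{K₁} w‖ < 1`. [folklore] -/
theorem hasFDerivAt_patchLift (v : V) (K₁ : Submodule ℝ E) {w : ↥(K₁ ⊔ Vᗮ)}
    (hw : ‖K₁.orthogonalProjectionOnto (w : E)‖ < 1) :
    HasFDerivAt (fun w : ↥(K₁ ⊔ Vᗮ) ↦
        (w : E) + Real.sqrt (1 - ‖K₁.orthogonalProjectionOnto (w : E)‖ ^ 2) • (v : E))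
      ((K₁ ⊔ Vᗮ).subtypeL +
        ((1 / (2 * Real.sqrt (1 - ‖K₁.orthogonalProjectionOnto (w : E)‖ ^ 2))) •
          (-((2 • innerSL ℝ (K₁.orthogonalProjectionOnto (w : E))).comp
            (K₁.orthogonalProjectionOnto.comp (K₁ ⊔ Vᗮ).subtypeL)))).smulRight (v : E)) w := by
  set T : ↥(K₁ ⊔ Vᗮ) →L[ℝ] K₁ := K₁.orthogonalProjectionOnto.comp (K₁ ⊔ Vᗮ).subtypeL with hT
  have hT' : ∀ w : ↥(K₁ ⊔ Vᗮ), T w = K₁.orthogonalProjectionOnto (w : E) := fun w ↦ rfl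
  have h0 : HasFDerivAt (fun w : ↥(K₁ ⊔ Vᗮ) ↦ ‖T w‖ ^ 2) ((2 • innerSL ℝ (T w)).comp T) w :=
    (hasStrictFDerivAt_norm_sq (T w)).hasFDerivAt.comp w T.hasFDerivAt
  have h1 : HasFDerivAt (fun w : ↥(K₁ ⊔ Vᗮ) ↦ 1 - ‖T w‖ ^ 2) (-((2 • innerSL ℝ (T w)).comp T)) w :=
    h0.const_sub 1
  have h2 : 1 - ‖T w‖ ^ 2 ≠ 0 := by rw [hT']; nlinarith [norm_nonneg (K₁.orthogonalProjectionOnto (w : E))]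
  have h3 := (h1.sqrt h2).smul_const (v : E)
  have h4 : HasFDerivAt (fun w : ↥(K₁ ⊔ Vᗮ) ↦ (w : E)) (K₁ ⊔ Vᗮ).subtypeL w :=
    ((K₁ ⊔ Vᗮ).subtypeL).hasFDerivAt
  exact h4.add h3

/-- The derivative bound `‖DG(w)‖ ≤ 1 + ‖P_{K₁} w‖/√(1 - ‖P_{K₁} w‖²)` (`‖v‖ = 1`). [folklore] -/
theorem norm_fderiv_patchLift_le (hv : ‖v‖ = 1) (K₁ : Submodule ℝ E) {w : ↥(K₁ ⊔ Vᗮ)}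
    (hw : ‖K₁.orthogonalProjectionOnto (w : E)‖ < 1) :
    ‖(K₁ ⊔ Vᗮ).subtypeL +
        ((1 / (2 * Real.sqrt (1 - ‖K₁.orthogonalProjectionOnto (w : E)‖ ^ 2))) •
          (-((2 • innerSL ℝ (K₁.orthogonalProjectionOnto (w : E))).comp
            (K₁.orthogonalProjectionOnto.comp (K₁ ⊔ Vᗮ).subtypeL)))).smulRight (v : E)‖ ≤
      1 + ‖K₁.orthogonalProjectionOnto (w : E)‖ /
        Real.sqrt (1 - ‖K₁.orthogonalProjectionOnto (w : E)‖ ^ 2) := by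
  set y : K₁ := K₁.orthogonalProjectionOnto (w : E) with hy_def
  have hs : 0 < Real.sqrt (1 - ‖y‖ ^ 2) := Real.sqrt_pos.2 (by nlinarith [norm_nonneg y])
  have hA : ‖(K₁ ⊔ Vᗮ).subtypeL‖ ≤ 1 := Submodule.norm_subtypeL_le _
  have hvE : ‖(v : E)‖ = 1 := by rw [show ‖(v : E)‖ = ‖v‖ from rfl]; exact hv
  have hT : ‖K₁.orthogonalProjectionOnto.comp (K₁ ⊔ Vᗮ).subtypeL‖ ≤ 1 := by
    refine (ContinuousLinearMap.opNorm_comp_le _ _).trans ?_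
    calc ‖K₁.orthogonalProjectionOnto‖ * ‖(K₁ ⊔ Vᗮ).subtypeL‖ ≤ 1 * 1 :=
          mul_le_mul (orthogonalProjectionOnto_norm_le K₁) hA (norm_nonneg ((K₁ ⊔ Vᗮ).subtypeL))
            zero_le_one
      _ = 1 := mul_one 1
  have hB : ‖((1 / (2 * Real.sqrt (1 - ‖y‖ ^ 2))) •
      (-((2 • innerSL ℝ y).comp (K₁.orthogonalProjectionOnto.comp (K₁ ⊔ Vᗮ).subtypeL)))).smulRight
        (v : E)‖ ≤ ‖y‖ / Real.sqrt (1 - ‖y‖ ^ 2) := by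
    rw [ContinuousLinearMap.norm_smulRight_apply, hvE, mul_one, norm_smul, norm_neg,
      Real.norm_eq_abs, abs_of_pos (by positivity)]
    have h2 : ‖(2 • innerSL ℝ y).comp (K₁.orthogonalProjectionOnto.comp (K₁ ⊔ Vᗮ).subtypeL)‖ ≤
        2 * ‖y‖ := by
      refine (ContinuousLinearMap.opNorm_comp_le _ _).trans ?_
      have h3 : ‖2 • innerSL ℝ y‖ ≤ 2 * ‖y‖ := by
        refine norm_nsmul_le.trans ?_
        rw [innerSL_apply_norm]
        norm_num
      calc ‖2 • innerSL ℝ y‖ * ‖K₁.orthogonalProjectionOnto.comp (K₁ ⊔ Vᗮ).subtypeL‖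
          ≤ 2 * ‖y‖ * 1 :=
            mul_le_mul h3 hT (norm_nonneg (K₁.orthogonalProjectionOnto.comp (K₁ ⊔ Vᗮ).subtypeL))
              (by positivity)
        _ = 2 * ‖y‖ := mul_one _
    calc 1 / (2 * Real.sqrt (1 - ‖y‖ ^ 2)) *
          ‖(2 • innerSL ℝ y).comp (K₁.orthogonalProjectionOnto.comp (K₁ ⊔ Vᗮ).subtypeL)‖
        ≤ 1 / (2 * Real.sqrt (1 - ‖y‖ ^ 2)) * (2 * ‖y‖) :=
          mul_le_mul_of_nonneg_left h2 (by positivity)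
      _ = ‖y‖ / Real.sqrt (1 - ‖y‖ ^ 2) := by field_simp
  have h := norm_add_le ((K₁ ⊔ Vᗮ).subtypeL)
    (((1 / (2 * Real.sqrt (1 - ‖y‖ ^ 2))) •
      (-((2 • innerSL ℝ y).comp (K₁.orthogonalProjectionOnto.comp (K₁ ⊔ Vᗮ).subtypeL)))).smulRight
        (v : E))
  exact h.trans (add_le_add hA hB)

/-- **The graph map is Lipschitz near the pole**: on the convex box
`Q = {w ∈ W | ‖P_{K₁} w‖ < ρ, ‖P_{Vᗮ} w‖ < ρ₂}` (`ρ < 1`), `G w = w + √(1 - ‖P_{K₁} w‖²) v` is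
Lipschitz with constant `1 + ρ/√(1 - ρ²)`. [folklore] -/
theorem lipschitzOnWith_patchLift (hv : ‖v‖ = 1) (K₁ : Submodule ℝ E) {ρ : ℝ} (hρ0 : 0 ≤ ρ)
    (hρ1 : ρ < 1) (ρ₂ : ℝ) :
    LipschitzOnWith (Real.toNNReal (1 + ρ / Real.sqrt (1 - ρ ^ 2)))
      (fun w : ↥(K₁ ⊔ Vᗮ) ↦
        (w : E) + Real.sqrt (1 - ‖K₁.orthogonalProjectionOnto (w : E)‖ ^ 2) • (v : E))
      {w : ↥(K₁ ⊔ Vᗮ) | ‖K₁.orthogonalProjectionOnto (w : E)‖ < ρ ∧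
        ‖Vᗮ.orthogonalProjectionOnto (w : E)‖ < ρ₂} := by
  have hconv : Convex ℝ {w : ↥(K₁ ⊔ Vᗮ) | ‖K₁.orthogonalProjectionOnto (w : E)‖ < ρ ∧
      ‖Vᗮ.orthogonalProjectionOnto (w : E)‖ < ρ₂} := by
    have h1 : Convex ℝ {w : ↥(K₁ ⊔ Vᗮ) | ‖K₁.orthogonalProjectionOnto (w : E)‖ < ρ} := by
      have : {w : ↥(K₁ ⊔ Vᗮ) | ‖K₁.orthogonalProjectionOnto (w : E)‖ < ρ} =
          (K₁.orthogonalProjectionOnto.comp (K₁ ⊔ Vᗮ).subtypeL) ⁻¹' ball 0 ρ := by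
        ext w; simp
      rw [this]
      exact (convex_ball (0 : K₁) ρ).linear_preimage _
    have h2 : Convex ℝ {w : ↥(K₁ ⊔ Vᗮ) | ‖Vᗮ.orthogonalProjectionOnto (w : E)‖ < ρ₂} := by
      have : {w : ↥(K₁ ⊔ Vᗮ) | ‖Vᗮ.orthogonalProjectionOnto (w : E)‖ < ρ₂} =
          (Vᗮ.orthogonalProjectionOnto.comp (K₁ ⊔ Vᗮ).subtypeL) ⁻¹' ball 0 ρ₂ := by
        ext w; simp
      rw [this]
      exact (convex_ball (0 : Vᗮ) ρ₂).linear_preimage _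
    simpa only [setOf_and] using h1.inter h2
  refine hconv.lipschitzOnWith_of_nnnorm_hasFDerivWithin_le (𝕜 := ℝ)
    (fun w hw ↦ (hasFDerivAt_patchLift v K₁ (hw.1.trans hρ1)).hasFDerivWithinAt) (fun w hw ↦ ?_)
  have hw1 : ‖K₁.orthogonalProjectionOnto (w : E)‖ < 1 := hw.1.trans hρ1
  rw [← NNReal.coe_le_coe, coe_nnnorm, Real.coe_toNNReal _ (by positivity)]
  refine (norm_fderiv_patchLift_le hv K₁ hw1).trans (add_le_add le_rfl ?_)
  have hs : 0 < Real.sqrt (1 - ρ ^ 2) := Real.sqrt_pos.2 (by nlinarith)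
  have hsy : Real.sqrt (1 - ρ ^ 2) ≤ Real.sqrt (1 - ‖K₁.orthogonalProjectionOnto (w : E)‖ ^ 2) :=
    Real.sqrt_le_sqrt (by nlinarith [norm_nonneg (K₁.orthogonalProjectionOnto (w : E)), hw.1])
  calc ‖K₁.orthogonalProjectionOnto (w : E)‖ / Real.sqrt (1 - ‖K₁.orthogonalProjectionOnto (w : E)‖ ^ 2)
      ≤ ρ / Real.sqrt (1 - ‖K₁.orthogonalProjectionOnto (w : E)‖ ^ 2) :=
        div_le_div_of_nonneg_right hw.1.le (hs.trans_le hsy).le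
    _ ≤ ρ / Real.sqrt (1 - ρ ^ 2) := div_le_div_of_nonneg_left hρ0 hs hsy

/-- **The patch is covered by the graph**: every point `z` of the cylinder with `P_V z` in the cap
of height `c` and `‖P_{Vᗮ} z‖ < ρ₂` is `G w` for some `w` in the box `Q` (namely
`w = (P_V z - ⟪v, P_V z⟫ v) + P_{Vᗮ} z`). [folklore] -/
theorem patch_subset_image_patchLift (hv : ‖v‖ = 1)
    (hK₁ : K₁ = ((ℝ ∙ v)ᗮ : Submodule ℝ V).map V.subtype) {c : ℝ} (hc0 : 0 < c) (ρ₂ : ℝ) :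
    {z : E | V.orthogonalProjectionOnto z ∈ cap v c ∧ ‖Vᗮ.orthogonalProjectionOnto z‖ < ρ₂} ⊆
      (fun w : ↥(K₁ ⊔ Vᗮ) ↦
        (w : E) + Real.sqrt (1 - ‖K₁.orthogonalProjectionOnto (w : E)‖ ^ 2) • (v : E)) ''
      {w : ↥(K₁ ⊔ Vᗮ) | ‖K₁.orthogonalProjectionOnto (w : E)‖ < Real.sqrt (1 - c ^ 2) ∧
        ‖Vᗮ.orthogonalProjectionOnto (w : E)‖ < ρ₂} := by
  rintro z ⟨hza, hzb⟩
  set a : V := V.orthogonalProjectionOnto z with ha_def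
  set b : Vᗮ := Vᗮ.orthogonalProjectionOnto z with hb_def
  set a' : ((ℝ ∙ v)ᗮ : Submodule ℝ V) := ((ℝ ∙ v)ᗮ : Submodule ℝ V).orthogonalProjectionOnto a
    with ha'_def
  have ha'K : ((a' : V) : E) ∈ K₁ := by
    rw [hK₁, Submodule.mem_map]
    exact ⟨a', a'.2, rfl⟩
  have hbK : (b : E) ∈ Vᗮ := b.2
  have hw : ((a' : V) : E) + (b : E) ∈ K₁ ⊔ Vᗮ := Submodule.add_mem_sup ha'K hbK
  refine ⟨⟨((a' : V) : E) + (b : E), hw⟩, ?_, ?_⟩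
  · -- `w ∈ Q`
    have hle : Vᗮ ≤ K₁ᗮ := (patchPlane_isOrtho hK₁).symm.le
    have hle' : K₁ ≤ Vᗮᗮ := (patchPlane_isOrtho hK₁).le
    have h1 : K₁.orthogonalProjectionOnto (((a' : V) : E) + (b : E)) = ⟨((a' : V) : E), ha'K⟩ := by
      rw [map_add, orthogonalProjectionOnto_apply_of_mem_orthogonal (hle hbK), add_zero]
      exact orthogonalProjectionOnto_mem_subspace_eq_self (⟨_, ha'K⟩ : K₁)
    have h2 : Vᗮ.orthogonalProjectionOnto (((a' : V) : E) + (b : E)) = b := by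
      rw [map_add, orthogonalProjectionOnto_apply_of_mem_orthogonal (hle' ha'K), zero_add,
        orthogonalProjectionOnto_mem_subspace_eq_self]
    simp only [mem_setOf_eq, h1, h2]
    refine ⟨?_, hzb⟩
    have : ‖(⟨((a' : V) : E), ha'K⟩ : K₁)‖ = ‖a'‖ := rfl
    rw [this]
    exact norm_orthogonalProjectionOnto_lt hv hc0 hza
  · -- `G w = z`
    have hle : Vᗮ ≤ K₁ᗮ := (patchPlane_isOrtho hK₁).symm.le
    have h1 : K₁.orthogonalProjectionOnto (((a' : V) : E) + (b : E)) = ⟨((a' : V) : E), ha'K⟩ := by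
      rw [map_add, orthogonalProjectionOnto_apply_of_mem_orthogonal (hle hbK), add_zero]
      exact orthogonalProjectionOnto_mem_subspace_eq_self (⟨_, ha'K⟩ : K₁)
    have hnorm : ‖(⟨((a' : V) : E), ha'K⟩ : K₁)‖ = ‖a'‖ := rfl
    have hlift : capLift v a' = a := capLift_orthogonalProjectionOnto hv hc0 hza
    simp only [h1, hnorm]
    have hlift' : ((a' : V) : E) + Real.sqrt (1 - ‖a'‖ ^ 2) • ((v : V) : E) = (a : E) := by
      rw [← hlift, capLift, Submodule.coe_add, Submodule.coe_smul]
    calc ((a' : V) : E) + (b : E) + Real.sqrt (1 - ‖a'‖ ^ 2) • (v : E)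
        = (((a' : V) : E) + Real.sqrt (1 - ‖a'‖ ^ 2) • (v : E)) + (b : E) := by abel
      _ = (a : E) + (b : E) := by rw [hlift']
      _ = z := by
        rw [ha_def, hb_def]
        exact starProjection_add_starProjection_orthogonal (K := V) z

end Lift

/-! ### The measure of a patch -/

section Measure

variable {V : Submodule ℝ E} {v : V} {K₁ : Submodule ℝ E} [FiniteDimensional ℝ E]
  [MeasurableSpace E] [BorelSpace E]

/-- **Upper bound for the Hausdorff measure of a patch**: with `ρ = √(1 - c²)`,
`μHE[n] {z | P_V z ∈ cap v c, ‖P_{Vᗮ} z‖ < ρ₂} ≤ (1 + ρ/c)^n · vol_{K₁}(B_ρ) · vol_{Vᗮ}(B_{ρ₂})`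
(`dim E = n + 1`, `dim V = k + 1`; Lipschitz graph over the box, whose volume in the `n`-plane
`K₁ ⊔ Vᗮ` is the product of the volumes by `volume_sup_setOf_orthogonalProjection_mem_prod`).
[folklore] -/
theorem euclideanHausdorffMeasure_patch_le {n k : ℕ} (hE : finrank ℝ E = n + 1)
    (hV : finrank ℝ V = k + 1) (hv : ‖v‖ = 1)
    (hK₁ : K₁ = ((ℝ ∙ v)ᗮ : Submodule ℝ V).map V.subtype) {c : ℝ} (hc0 : 0 < c) (hc1 : c < 1)
    (ρ₂ : ℝ) :
    (μHE[n] : Measure E)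
        {z : E | V.orthogonalProjectionOnto z ∈ cap v c ∧ ‖Vᗮ.orthogonalProjectionOnto z‖ < ρ₂} ≤
      ENNReal.ofReal ((1 + Real.sqrt (1 - c ^ 2) / c) ^ n) *
        ((volume : Measure K₁) (ball 0 (Real.sqrt (1 - c ^ 2))) *
          (volume : Measure Vᗮ) (ball 0 ρ₂)) := by
  set ρ := Real.sqrt (1 - c ^ 2) with hρ_def
  have hρ0 : 0 ≤ ρ := Real.sqrt_nonneg _
  have hρ1 : ρ < 1 := by rw [hρ_def, Real.sqrt_lt' one_pos]; nlinarith
  have hcρ : Real.sqrt (1 - ρ ^ 2) = c := by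
    rw [hρ_def, Real.sq_sqrt (by nlinarith)]
    rw [show 1 - (1 - c ^ 2) = c ^ 2 by ring, Real.sqrt_sq hc0.le]
  have hW : finrank ℝ ↥(K₁ ⊔ Vᗮ) = n := finrank_patchPlane_sup hE hV hv hK₁
  -- the box and its volume
  have hQ : (μHE[n] : Measure ↥(K₁ ⊔ Vᗮ))
      {w : ↥(K₁ ⊔ Vᗮ) | ‖K₁.orthogonalProjectionOnto (w : E)‖ < ρ ∧
        ‖Vᗮ.orthogonalProjectionOnto (w : E)‖ < ρ₂} =
      (volume : Measure K₁) (ball 0 ρ) * (volume : Measure Vᗮ) (ball 0 ρ₂) := by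
    have hset : {w : ↥(K₁ ⊔ Vᗮ) | ‖K₁.orthogonalProjectionOnto (w : E)‖ < ρ ∧
        ‖Vᗮ.orthogonalProjectionOnto (w : E)‖ < ρ₂} =
        {w : ↥(K₁ ⊔ Vᗮ) | K₁.orthogonalProjectionOnto (w : E) ∈ ball (0 : K₁) ρ ∧
          Vᗮ.orthogonalProjectionOnto (w : E) ∈ ball (0 : Vᗮ) ρ₂} := by
      ext w; simp
    subst hW
    rw [hset, InnerProductSpace.euclideanHausdorffMeasure_eq_volume]
    exact volume_sup_setOf_orthogonalProjection_mem_prod K₁ Vᗮ (patchPlane_isOrtho hK₁)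
      measurableSet_ball measurableSet_ball
  have hLip := (lipschitzOnWith_patchLift hv K₁ hρ0 hρ1 ρ₂).euclideanHausdorffMeasure_image_le n
  rw [hcρ, hQ] at hLip
  refine (measure_mono (patch_subset_image_patchLift hv hK₁ hc0 ρ₂)).trans (hLip.trans ?_)
  gcongr
  apply le_of_eq
  rw [ENNReal.ofReal_pow (by positivity)]
  rfl

/-- The bound of `euclideanHausdorffMeasure_patch_le` is finite. [folklore] -/
theorem euclideanHausdorffMeasure_patch_lt_top {n k : ℕ} (hE : finrank ℝ E = n + 1)
    (hV : finrank ℝ V = k + 1) (hv : ‖v‖ = 1) {c : ℝ} (hc0 : 0 < c) (hc1 : c < 1) (ρ₂ : ℝ) :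
    (μHE[n] : Measure E)
        {z : E | V.orthogonalProjectionOnto z ∈ cap v c ∧ ‖Vᗮ.orthogonalProjectionOnto z‖ < ρ₂} < ⊤ := by
  refine (euclideanHausdorffMeasure_patch_le hE hV hv rfl hc0 hc1 ρ₂).trans_lt ?_
  refine ENNReal.mul_lt_top ENNReal.ofReal_lt_top (ENNReal.mul_lt_top ?_ ?_)
  · exact measure_ball_lt_top
  · exact measure_ball_lt_top

end Measure

end Literature.MeasureTheory.Hausdorff

end
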